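import Summits.RiemannHypothesis.RiemannHypothesis.Theorems.GroundBartaEvenWinsBeyondArchDeflationCutRitz
import Summits.RiemannHypothesis.RiemannHypothesis.Theorems.GroundBartaEvenWinsBeyondArchDeflationShellTransfer
import Summits.RiemannHypothesis.RiemannHypothesis.Theorems.GroundBartaEvenWinsBeyondArchDeflationCertLeak
import Summits.RiemannHypothesis.RiemannHypothesis.Theorems.GroundBartaEvenWinsBeyondArchDeflationCertBridgeW
import HarnessLib

/-!
# RiemannHypothesis / GroundBarta — rung 4 (`EvenWinsBeyondArch`, stmt-RiemannHypothesis-18807 / 18085):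
# the deflated Temple L-side for the ENDPOINT CELL — bridge from a two-prime certificate with cut vectors,
# leaky penalties, extended images and the edge-only sliver (weighted criterion)

Helper file (`--supports stmt-RiemannHypothesis-18085`), RH-free, no definitions, no named facts.  Prover B (gen 6 of
unit `sr-gb-rung-b`).

`dt_weil{Odd,Even}GroundEnergy_ge_of_deflCert_w` (prover A/B, cells 1–5 of the parity ladder and the positivity blocks)
need the test window `c` to be the rational cut of the trial vectors.  This file is the variant for an ARBITRARY test
window `c` in the three-prime band with
  `log 2 < c' ≤ c ≤ (log 5)/2`, `c ≤ b`, `c ≤ a₀`  (`c'`, `b`, `a₀` rational in the applications, `c = (log 5)/2`):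

* the rank-one augmented two-prime certificate `hcert23` lives on `[-a₀, a₀]` (penalty data `R`, level `β₂₃`);
* the trial vectors are the penalty polynomials CUT AT `c'`: `v_i = 𝟙_{[-c',c']} · maskPoly R_i n a₀`;
* the residual data are those of the EXTENDED images `Fx_i = 𝟙_{[-b,b]}·(pole + primes(c') + arch)(v_i) − M_{c'} v_i`
  (indicator widened to `b ≥ c`, prime index and killing constant of the band), which agree with the window-`c` images
  on `[-c, c]`;
* the penalty leak `ν ≥ Σ_i μ_i ∫_{[-a₀,a₀]∖[-c',c']} p_i²` lowers the complement level to `β' = β₂₃ − 2ν` (weights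
  `wI = 1/(β' − λ)` inside `|y| < y₁`, `wE = 1/(β' − κ₂ − λ)` on `|y| ≥ y₁`, `y₁ ≤ log 4 − c`, `κ₂ ≥ (log 2)/2`);
* the PSD datum `A(c') − λG − R_w(Fx) ⪰ 0` is stated with the window-`c'` matrix entries (band invariance).

Conclusion: `λ ≤ ε_od(c)` / `λ ≤ ε_ev(c)`.  Ingredients: `dt_cert_leak` (…CertLeak), `dt_weil*GroundEnergy_ge_of_cut_w`
(…CutRitz), `dt_hPSD_of_dominated` + band invariance (…ShellTransfer), the edge sliver (…SliverEdge).
-/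

set_option linter.dupNamespace false

noncomputable section

open MeasureTheory Set Filter
open scoped Topology ENNReal NNReal ComplexConjugate BigOperators

namespace Summit.RiemannHypothesis.RiemannHypothesis.Theorems.EvenWinsBeyondArch

open Literature.NumberTheory.LFunctions Literature.NumberTheory.LFunctions.ConnesVanSuijlekom
open Summit.RiemannHypothesis.RiemannHypothesis.Theorems.OddSector (weilDirichletEnergy₂ weilPoleForm₂)
open Summit.RiemannHypothesis.RiemannHypothesis.Theorems.GroundStateSimpleEven (incs_memLp)

/-- **An extended window image is in `L²`**: for `v ∈ L²` with an a.e. archimedean majorant on `(-b, b)`, any finite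
index set `P` and any constant `M`, `𝟙_{[-b,b]}·(pole + Σ_{n∈P} Λ(n)n^{-1/2}(2v − v(·−log n) − v(·+log n)) + arch) − M v ∈ L²`.
[cite: Bombieri2000Weil, §4 Lemma 1 eq. (4.2)] -/
theorem dt_windowImageX_memLp {b : ℝ} {v Fx : ℝ → ℂ} (hv : MemLp v 2) {m : ℝ → ℝ} (hm : MemLp m 2)
    (hH : ∀ᵐ y : ℝ, y ∈ Ioo (-b) b →
      IntegrableOn (fun t ↦ weilArchDensity t * ‖2 * v y - v (y - t) - v (y + t)‖) (Ioi 0) ∧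
        ∫ t in Ioi 0, weilArchDensity t * ‖2 * v y - v (y - t) - v (y + t)‖ ≤ m y)
    (P : Finset ℕ) (M : ℝ)
    (hFx : ∀ y, Fx y = (Icc (-b) b).indicator (fun y ↦
        2 * (∫ x, v x * (Real.cosh (x / 2) : ℂ)) * (Real.cosh (y / 2) : ℂ) -
          2 * (∫ x, v x * (Real.sinh (x / 2) : ℂ)) * (Real.sinh (y / 2) : ℂ) +
        (∑ n ∈ P, (((ArithmeticFunction.vonMangoldt n : ℝ) / Real.sqrt n : ℝ) : ℂ) *
          (2 * v y - v (y - Real.log n) - v (y + Real.log n))) +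
        ∫ t in Ioi 0, (weilArchDensity t : ℂ) * (2 * v y - v (y - t) - v (y + t))) y -
      (M : ℂ) * v y) :
    MemLp Fx 2 := by
  have eF : Fx = (Icc (-b) b).indicator (fun y ↦
        2 * (∫ x, v x * (Real.cosh (x / 2) : ℂ)) * (Real.cosh (y / 2) : ℂ) -
          2 * (∫ x, v x * (Real.sinh (x / 2) : ℂ)) * (Real.sinh (y / 2) : ℂ)) +
      ((Icc (-b) b).indicator (fun y ↦
        ∑ n ∈ P, (((ArithmeticFunction.vonMangoldt n : ℝ) / Real.sqrt n : ℝ) : ℂ) *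
          (2 * v y - v (y - Real.log n) - v (y + Real.log n))) +
      ((Icc (-b) b).indicator (fun y ↦
        ∫ t in Ioi 0, (weilArchDensity t : ℂ) * (2 * v y - v (y - t) - v (y + t))) -
      fun y ↦ (M : ℂ) * v y)) := by
    funext y
    rw [hFx y]
    simp only [Pi.add_apply, Pi.sub_apply]
    by_cases hy : y ∈ Icc (-b) b
    · simp only [indicator_of_mem hy]; ring
    · simp only [indicator_of_notMem hy]; ring
  rw [eF]
  refine MemLp.add ?_ (MemLp.add ?_ (MemLp.sub (dt_memLp_archLayer_ae hv hm hH) (hv.const_mul _)))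
  · rw [memLp_indicator_iff_restrict measurableSet_Icc]
    have hcont : Continuous fun y : ℝ ↦
        2 * (∫ x, v x * (Real.cosh (x / 2) : ℂ)) * (Real.cosh (y / 2) : ℂ) -
          2 * (∫ x, v x * (Real.sinh (x / 2) : ℂ)) * (Real.sinh (y / 2) : ℂ) := by fun_prop
    obtain ⟨C, hC⟩ := isCompact_Icc.exists_bound_of_continuousOn (hcont.continuousOn (s := Icc (-b) b))
    exact MemLp.of_bound hcont.aestronglyMeasurable.restrict C
      ((ae_restrict_iff' measurableSet_Icc).2 (Eventually.of_forall fun y hy ↦ hC y hy))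
  · refine MemLp.indicator measurableSet_Icc (memLp_finsetSum _ fun n _ ↦ ?_)
    exact (dt_memLp_secondDiff hv _).const_mul _

/-- **The endpoint-cell bridge, parity `σ`.**  See the module docstring: certificate on `[-a₀, a₀]` (parity predicate
`g(-x) = σ g(x)`), vectors cut at `c'`, extended images at `b`, leak `ν`, weighted PSD datum with the window-`c'` matrix
⇒ `λ∫|φ|² ≤ Re Q(φ)` for every smooth parity-`σ` test `φ` of the window `[-c, c]`. [folklore] -/
theorem dt_sector_bound_of_deflCert_wx {c c' b a₀ : ℝ} (hc'2 : Real.log 2 < c') (hcc : c' ≤ c)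
    (hc5 : c ≤ Real.log 5 / 2) (hcb : c ≤ b) (hca : c ≤ a₀) (σ : ℝ)
    (R : List (ℚ × ℕ × List ℚ)) (n : ℕ) {β₂₃ : ℝ}
    (hRpar : ∀ (i : Fin R.length) (x : ℝ), maskPoly (R.get i) n a₀ (-x) = σ * maskPoly (R.get i) n a₀ x)
    (hRμ : ∀ i : Fin R.length, 0 ≤ (R.get i).1)
    (hcert23 : ∀ g : ℝ → ℂ, IsWeilTest g → tsupport g ⊆ Icc (-a₀) a₀ → (∀ x, g (-x) = (σ : ℂ) * g x) →
      β₂₃ * weilNorm2Sq g ≤ weilTwoPrimeQuadratic g +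
        (R.map fun r ↦ (r.1 : ℝ) * ‖∑ k ∈ Finset.range n, ((maskV r k : ℚ) : ℂ) * weilMoment a₀ g k‖ ^ 2).sum)
    (v Fx : Fin R.length → ℝ → ℂ)
    (hv : ∀ i x, v i x = (((Icc (-c') c').indicator (fun x ↦ maskPoly (R.get i) n a₀ x) x : ℝ) : ℂ))
    (hFx : ∀ i y, Fx i y = (Icc (-b) b).indicator (fun y ↦
        2 * (∫ x, v i x * (Real.cosh (x / 2) : ℂ)) * (Real.cosh (y / 2) : ℂ) -
          2 * (∫ x, v i x * (Real.sinh (x / 2) : ℂ)) * (Real.sinh (y / 2) : ℂ) +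
        (∑ m ∈ weilPrimeIndex c', (((ArithmeticFunction.vonMangoldt m : ℝ) / Real.sqrt m : ℝ) : ℂ) *
          (2 * v i y - v i (y - Real.log m) - v i (y + Real.log m))) +
        ∫ t in Ioi 0, (weilArchDensity t : ℂ) * (2 * v i y - v i (y - t) - v i (y + t))) y -
      (weilMarkovConstant c' : ℂ) * v i y)
    (W : Fin R.length → Fin R.length → ℝ) {κ₂ : ℝ} (hκ : Real.log 2 / 2 ≤ κ₂)
    {ν : ℝ} (hν : ∑ i : Fin R.length, ((R.get i).1 : ℝ) *
      ∫ x in Icc (-a₀) a₀ \ Icc (-c') c', (maskPoly (R.get i) n a₀ x) ^ 2 ≤ ν)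
    {lam : ℝ} (hlam : lam < β₂₃ - 2 * ν - κ₂) {y₁ : ℝ} (hy : y₁ ≤ Real.log 4 - c)
    (hPSD : ∀ α : Fin R.length → ℝ, 0 ≤ ∑ i, ∑ j, α i * α j *
      ((weilPoleForm₂ (v i) (v j) + weilDirichletEnergy₂ c' (v i) (v j) -
          weilMarkovConstant c' * ∫ x, (v i x * conj (v j x)).re) - lam * (∫ x, (v i x * conj (v j x)).re) -
        ∫ y, {u : ℝ | y₁ ≤ |u|}.piecewise (fun _ ↦ 1 / (β₂₃ - 2 * ν - κ₂ - lam))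
            (fun _ ↦ 1 / (β₂₃ - 2 * ν - lam)) y *
          ((Fx i - ∑ l, W i l • v l) y * conj ((Fx j - ∑ l, W j l • v l) y)).re))
    {φ : ℝ → ℂ} (hφ : IsWeilTest φ) (hφs : tsupport φ ⊆ Icc (-c) c) (hφp : ∀ x, φ (-x) = (σ : ℂ) * φ x) :
    lam * ∫ x, ‖φ x‖ ^ 2 ≤ (weilQuadratic φ).re := by
  have hlog2 : 0 < Real.log 2 := Real.log_pos (by norm_num)
  have hc' : 0 < c' := hlog2.trans hc'2
  have hc : 0 < c := lt_of_lt_of_le hc' hcc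
  have hcb' : c' ≤ b := hcc.trans hcb
  have hE : MeasurableSet {u : ℝ | y₁ ≤ |u|} := measurableSet_le measurable_const continuous_abs.measurable
  -- the window-`c` images
  set F : Fin R.length → ℝ → ℂ := fun i y ↦ (Icc (-c) c).indicator (fun y ↦
        2 * (∫ x, v i x * (Real.cosh (x / 2) : ℂ)) * (Real.cosh (y / 2) : ℂ) -
          2 * (∫ x, v i x * (Real.sinh (x / 2) : ℂ)) * (Real.sinh (y / 2) : ℂ) +
        (∑ m ∈ weilPrimeIndex c, (((ArithmeticFunction.vonMangoldt m : ℝ) / Real.sqrt m : ℝ) : ℂ) *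
          (2 * v i y - v i (y - Real.log m) - v i (y + Real.log m))) +
        ∫ t in Ioi 0, (weilArchDensity t : ℂ) * (2 * v i y - v i (y - t) - v i (y + t))) y -
      (weilMarkovConstant c : ℂ) * v i y with hFdef
  -- band invariance
  have hPI : weilPrimeIndex c = weilPrimeIndex c' := dt_weilPrimeIndex_eq_of_band hc'2 hcc hc5
  have hM : weilMarkovConstant c = weilMarkovConstant c' := dt_weilMarkovConstant_eq_of_band hc'2 hcc hc5
  have hE₂ : ∀ f h, weilDirichletEnergy₂ c f h = weilDirichletEnergy₂ c' f h := fun f h ↦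
    dt_weilDirichletEnergy₂_eq_of_band hc'2 hcc hc5 f h
  -- the vectors
  have hpc : ∀ i, ContDiff ℝ 2 fun x ↦ maskPoly (R.get i) n a₀ x := fun i ↦ contDiff_maskPoly (R.get i) n a₀
  have hvM : ∀ i, MemLp (v i) 2 := fun i ↦ (dt_cut_mem_formDomain hc' hcc σ ((hpc i).of_le (by norm_num))
    (hRpar i) (hv i)).1
  have hvout : ∀ i y, y ∉ Icc (-c') c' → v i y = 0 := fun i y hy ↦ by rw [hv i y, indicator_of_notMem hy]; simp
  -- weights
  set nE : ℝ := β₂₃ - 2 * ν - κ₂ - lam with hnE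
  set nI : ℝ := β₂₃ - 2 * ν - lam with hnI
  have hnE0 : 0 < nE := by rw [hnE]; linarith
  have hκ0 : 0 ≤ κ₂ := le_trans (by positivity) hκ
  have hnI0 : 0 < nI := by rw [hnI]; linarith
  have hnEI : nE ≤ nI := by rw [hnE, hnI]; linarith
  set C : ℝ := nI + 1 / nE with hC
  have hpw : ∀ (a₁ a₂ : ℝ) (y : ℝ), {u : ℝ | y₁ ≤ |u|}.piecewise (fun _ ↦ a₁) (fun _ ↦ a₂) y = a₁ ∨
      {u : ℝ | y₁ ≤ |u|}.piecewise (fun _ ↦ a₁) (fun _ ↦ a₂) y = a₂ := by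
    intro a₁ a₂ y
    by_cases hy' : y ∈ {u : ℝ | y₁ ≤ |u|}
    · exact Or.inl (Set.piecewise_eq_of_mem _ _ _ hy')
    · exact Or.inr (Set.piecewise_eq_of_notMem _ _ _ hy')
  have hmeas : ∀ a₁ a₂ : ℝ, Measurable ({u : ℝ | y₁ ≤ |u|}.piecewise (fun _ ↦ a₁) (fun _ ↦ a₂)) := fun a₁ a₂ ↦
    Measurable.piecewise hE measurable_const measurable_const
  set w : ℝ → ℝ := {u : ℝ | y₁ ≤ |u|}.piecewise (fun _ ↦ 1 / nE) (fun _ ↦ 1 / nI) with hwdef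
  have hwC : ∀ y, |w y| ≤ C := by
    intro y
    have h1 : 1 / nI ≤ 1 / nE := one_div_le_one_div_of_le hnE0 hnEI
    rcases hpw (1 / nE) (1 / nI) y with h | h <;> rw [hwdef, h]
    · rw [abs_of_pos (by positivity), hC]; linarith [hnI0.le]
    · rw [abs_of_pos (by positivity), hC]; linarith [hnI0.le]
  have hw0 : ∀ y, 0 ≤ w y := by
    intro y; rcases hpw (1 / nE) (1 / nI) y with h | h <;> rw [hwdef, h] <;> positivity
  -- the PSD datum at the window `c`
  have hPSD' : ∀ α : Fin R.length → ℝ, 0 ≤ ∑ i, ∑ j, α i * α j *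
      ((weilPoleForm₂ (v i) (v j) + weilDirichletEnergy₂ c (v i) (v j) -
          weilMarkovConstant c * ∫ x, (v i x * conj (v j x)).re) - lam * (∫ x, (v i x * conj (v j x)).re) -
        ∫ y, w y * ((F i - ∑ l, W i l • v l) y * conj ((F j - ∑ l, W j l • v l) y)).re) := by
    -- residuals in `L²`
    have hr : ∀ i, MemLp (F i - ∑ l, W i l • v l) 2 := by
      intro i
      obtain ⟨m, hm, hH⟩ := dt_exists_majorant_of_contDiff_cut hc' hcc (hpc i) (hv i)
      exact (dt_windowImage_memLp_ae (hvM i) hm hH (fun y ↦ by rw [hFdef])).sub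
        (memLp_finsetSum' _ fun l _ ↦ (hvM l).const_smul _)
    have hrx : ∀ i, MemLp (Fx i - ∑ l, W i l • v l) 2 := by
      intro i
      obtain ⟨m, hm, hH⟩ := dt_exists_majorant_of_contDiff_cut hc' hcb' (hpc i) (hv i)
      exact (dt_windowImageX_memLp (hvM i) hm hH (weilPrimeIndex c') (weilMarkovConstant c') (hFx i)).sub
        (memLp_finsetSum' _ fun l _ ↦ (hvM l).const_smul _)
    -- pointwise: `F = Fx` on `[-c, c]`, `F − ΣWv = 0` off `[-c, c]`
    have hdom : ∀ y, (∀ i, (F i - ∑ l, W i l • v l) y = (Fx i - ∑ l, W i l • v l) y) ∨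
        (∀ i, (F i - ∑ l, W i l • v l) y = 0) := by
      intro y
      by_cases hy' : y ∈ Icc (-c) c
      · refine Or.inl fun i ↦ ?_
        have hyb : y ∈ Icc (-b) b := Icc_subset_Icc (by linarith) hcb hy'
        simp only [Pi.sub_apply, hFdef, hFx i y, indicator_of_mem hy', indicator_of_mem hyb, hPI, hM]
      · refine Or.inr fun i ↦ ?_
        have hvy : ∀ l, v l y = 0 := fun l ↦ hvout l y fun h ↦ hy' (Icc_subset_Icc (by linarith) hcc h)
        simp only [Pi.sub_apply, Finset.sum_apply, Pi.smul_apply, hFdef, indicator_of_notMem hy', hvy, smul_zero,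
          Finset.sum_const_zero, mul_zero, sub_zero]
    intro α
    have h := dt_hPSD_of_dominated
      (fun i j ↦ (weilPoleForm₂ (v i) (v j) + weilDirichletEnergy₂ c' (v i) (v j) -
          weilMarkovConstant c' * ∫ x, (v i x * conj (v j x)).re) - lam * ∫ x, (v i x * conj (v j x)).re)
      (hmeas _ _) hwC hw0 (fun i ↦ F i - ∑ l, W i l • v l) (fun i ↦ Fx i - ∑ l, W i l • v l) hr hrx hdom
      (fun α ↦ by simpa only [hwdef, hnE, hnI] using hPSD α) α
    simpa only [hE₂, hM] using h
  -- apply the cut Ritz theorem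
  refine dt_sector_bound_of_cut_w hc' hcc σ (fun i x ↦ maskPoly (R.get i) n a₀ x) hpc hRpar v F hv
    (fun i y ↦ by rw [hFdef]) W (fun i ↦ 2 * ((R.get i).1 : ℝ)) lam
    (fun i ↦ mul_nonneg zero_le_two (by exact_mod_cast hRμ i))
    (n := {u : ℝ | y₁ ≤ |u|}.piecewise (fun _ ↦ nE) (fun _ ↦ nI)) (w := w) (C := C)
    (hmeas _ _) (hmeas _ _) ?_ hwC ?_ hw0 ?_ ?_ hPSD' hφ hφs hφp
  · -- |n| ≤ C
    intro y
    have h1 : 0 ≤ 1 / nE := by positivity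
    rcases hpw nE nI y with h | h <;> rw [h]
    · rw [abs_of_pos hnE0, hC]; linarith
    · rw [abs_of_pos hnI0, hC]; linarith
  · intro y; rcases hpw nE nI y with h | h <;> rw [h] <;> positivity
  · -- w n = 1
    intro y
    by_cases hy' : y ∈ {u : ℝ | y₁ ≤ |u|}
    · rw [hwdef, Set.piecewise_eq_of_mem _ _ _ hy', Set.piecewise_eq_of_mem _ _ _ hy']; field_simp
    · rw [hwdef, Set.piecewise_eq_of_notMem _ _ _ hy', Set.piecewise_eq_of_notMem _ _ _ hy']; field_simp
  · -- the leaky weighted certificate on smooth parity-σ tests of the window `c`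
    intro ψ hψ hψs hψp
    have hψa : tsupport ψ ⊆ Icc (-a₀) a₀ := hψs.trans (Icc_subset_Icc (by linarith) hca)
    have h23 := hcert23 ψ hψ hψa hψp
    have hleak := dt_cert_leak R n hcc hca hRμ hψ hψs h23 v hv hν
    have hsl := dt_weilTwoPrimeQuadratic_sub_edge_le_weilQuadratic_re hψ hψs hc5 hy
    have h2 : Integrable fun u : ℝ ↦ ‖ψ u‖ ^ 2 := hψ.integrable_norm_sq
    have hn_int : (∫ y, {u : ℝ | y₁ ≤ |u|}.piecewise (fun _ ↦ nE) (fun _ ↦ nI) y * ‖ψ y‖ ^ 2) =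
        nI * (∫ y, ‖ψ y‖ ^ 2) + (nE - nI) * ∫ y, {u : ℝ | y₁ ≤ |u|}.indicator (fun u ↦ ‖ψ u‖ ^ 2) y :=
      dt_integral_piecewise_mul hE nE nI h2
    have hEI : nE - nI = -κ₂ := by rw [hnE, hnI]; ring
    rw [hn_int, hEI, hnI]
    have hX0 : 0 ≤ ∫ y, {u : ℝ | y₁ ≤ |u|}.indicator (fun u ↦ ‖ψ u‖ ^ 2) y :=
      integral_nonneg fun y ↦ Set.indicator_nonneg (fun _ _ ↦ by positivity) y
    have hκX := mul_le_mul_of_nonneg_right hκ hX0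
    have : (β₂₃ - 2 * ν - lam) * (∫ y, ‖ψ y‖ ^ 2) +
        -κ₂ * (∫ y, {u : ℝ | y₁ ≤ |u|}.indicator (fun u ↦ ‖ψ u‖ ^ 2) y) + lam * ∫ x, ‖ψ x‖ ^ 2 =
        (β₂₃ - 2 * ν) * (∫ y, ‖ψ y‖ ^ 2) - κ₂ * ∫ y, {u : ℝ | y₁ ≤ |u|}.indicator (fun u ↦ ‖ψ u‖ ^ 2) y := by
      ring
    rw [this]
    linarith

/-- **`λ ≤ ε_od(c)` for the endpoint cell** (odd penalties): the odd-sector form of `dt_sector_bound_of_deflCert_wx`.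
[folklore] -/
theorem dt_weilOddGroundEnergy_ge_of_deflCert_wx {c c' b a₀ : ℝ} (hc'2 : Real.log 2 < c') (hcc : c' ≤ c)
    (hc5 : c ≤ Real.log 5 / 2) (hcb : c ≤ b) (hca : c ≤ a₀)
    (R : List (ℚ × ℕ × List ℚ)) (n : ℕ) {β₂₃ : ℝ}
    (hRodd : ∀ i : Fin R.length, (R.get i).2.1 % 2 = 1) (hRμ : ∀ i : Fin R.length, 0 ≤ (R.get i).1)
    (hcert23 : ∀ g : ℝ → ℂ, IsWeilTest g → tsupport g ⊆ Icc (-a₀) a₀ → (∀ x, g (-x) = -g x) →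
      β₂₃ * weilNorm2Sq g ≤ weilTwoPrimeQuadratic g +
        (R.map fun r ↦ (r.1 : ℝ) * ‖∑ k ∈ Finset.range n, ((maskV r k : ℚ) : ℂ) * weilMoment a₀ g k‖ ^ 2).sum)
    (v Fx : Fin R.length → ℝ → ℂ)
    (hv : ∀ i x, v i x = (((Icc (-c') c').indicator (fun x ↦ maskPoly (R.get i) n a₀ x) x : ℝ) : ℂ))
    (hFx : ∀ i y, Fx i y = (Icc (-b) b).indicator (fun y ↦
        2 * (∫ x, v i x * (Real.cosh (x / 2) : ℂ)) * (Real.cosh (y / 2) : ℂ) -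
          2 * (∫ x, v i x * (Real.sinh (x / 2) : ℂ)) * (Real.sinh (y / 2) : ℂ) +
        (∑ m ∈ weilPrimeIndex c', (((ArithmeticFunction.vonMangoldt m : ℝ) / Real.sqrt m : ℝ) : ℂ) *
          (2 * v i y - v i (y - Real.log m) - v i (y + Real.log m))) +
        ∫ t in Ioi 0, (weilArchDensity t : ℂ) * (2 * v i y - v i (y - t) - v i (y + t))) y -
      (weilMarkovConstant c' : ℂ) * v i y)
    (W : Fin R.length → Fin R.length → ℝ) {κ₂ : ℝ} (hκ : Real.log 2 / 2 ≤ κ₂)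
    {ν : ℝ} (hν : ∑ i : Fin R.length, ((R.get i).1 : ℝ) *
      ∫ x in Icc (-a₀) a₀ \ Icc (-c') c', (maskPoly (R.get i) n a₀ x) ^ 2 ≤ ν)
    {lam : ℝ} (hlam : lam < β₂₃ - 2 * ν - κ₂) {y₁ : ℝ} (hy : y₁ ≤ Real.log 4 - c)
    (hPSD : ∀ α : Fin R.length → ℝ, 0 ≤ ∑ i, ∑ j, α i * α j *
      ((weilPoleForm₂ (v i) (v j) + weilDirichletEnergy₂ c' (v i) (v j) -
          weilMarkovConstant c' * ∫ x, (v i x * conj (v j x)).re) - lam * (∫ x, (v i x * conj (v j x)).re) -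
        ∫ y, {u : ℝ | y₁ ≤ |u|}.piecewise (fun _ ↦ 1 / (β₂₃ - 2 * ν - κ₂ - lam))
            (fun _ ↦ 1 / (β₂₃ - 2 * ν - lam)) y *
          ((Fx i - ∑ l, W i l • v l) y * conj ((Fx j - ∑ l, W j l • v l) y)).re)) :
    lam ≤ weilOddGroundEnergy c := by
  have hc : 0 < c := lt_of_lt_of_le ((Real.log_pos (by norm_num)).trans hc'2) hcc
  refine le_weilOddGroundEnergy_of_forall hc fun φ hφ hφs hφo hφn ↦ ?_
  have h := dt_sector_bound_of_deflCert_wx hc'2 hcc hc5 hcb hca (-1) R n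
    (fun i x ↦ by rw [maskPoly_neg_of_odd (R.get i) (hRodd i) n a₀ x]; ring) hRμ
    (fun g hg hgs hgp ↦ hcert23 g hg hgs (fun x ↦ by simpa using hgp x)) v Fx hv hFx W hκ hν hlam hy hPSD hφ hφs
    (fun x ↦ by simpa using hφo x)
  rwa [hφn, mul_one] at h

/-- **`λ ≤ ε_ev(c)` for the endpoint cell** (even penalties): the even-sector form of `dt_sector_bound_of_deflCert_wx`.
With `λ = 0` this is the positivity-grade even block of the window `c`. [folklore] -/
theorem dt_weilEvenGroundEnergy_ge_of_deflCert_wx {c c' b a₀ : ℝ} (hc'2 : Real.log 2 < c') (hcc : c' ≤ c)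
    (hc5 : c ≤ Real.log 5 / 2) (hcb : c ≤ b) (hca : c ≤ a₀)
    (R : List (ℚ × ℕ × List ℚ)) (n : ℕ) {β₂₃ : ℝ}
    (hReven : ∀ i : Fin R.length, (R.get i).2.1 % 2 = 0) (hRμ : ∀ i : Fin R.length, 0 ≤ (R.get i).1)
    (hcert23 : ∀ g : ℝ → ℂ, IsWeilTest g → tsupport g ⊆ Icc (-a₀) a₀ → (∀ x, g (-x) = g x) →
      β₂₃ * weilNorm2Sq g ≤ weilTwoPrimeQuadratic g +
        (R.map fun r ↦ (r.1 : ℝ) * ‖∑ k ∈ Finset.range n, ((maskV r k : ℚ) : ℂ) * weilMoment a₀ g k‖ ^ 2).sum)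
    (v Fx : Fin R.length → ℝ → ℂ)
    (hv : ∀ i x, v i x = (((Icc (-c') c').indicator (fun x ↦ maskPoly (R.get i) n a₀ x) x : ℝ) : ℂ))
    (hFx : ∀ i y, Fx i y = (Icc (-b) b).indicator (fun y ↦
        2 * (∫ x, v i x * (Real.cosh (x / 2) : ℂ)) * (Real.cosh (y / 2) : ℂ) -
          2 * (∫ x, v i x * (Real.sinh (x / 2) : ℂ)) * (Real.sinh (y / 2) : ℂ) +
        (∑ m ∈ weilPrimeIndex c', (((ArithmeticFunction.vonMangoldt m : ℝ) / Real.sqrt m : ℝ) : ℂ) *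
          (2 * v i y - v i (y - Real.log m) - v i (y + Real.log m))) +
        ∫ t in Ioi 0, (weilArchDensity t : ℂ) * (2 * v i y - v i (y - t) - v i (y + t))) y -
      (weilMarkovConstant c' : ℂ) * v i y)
    (W : Fin R.length → Fin R.length → ℝ) {κ₂ : ℝ} (hκ : Real.log 2 / 2 ≤ κ₂)
    {ν : ℝ} (hν : ∑ i : Fin R.length, ((R.get i).1 : ℝ) *
      ∫ x in Icc (-a₀) a₀ \ Icc (-c') c', (maskPoly (R.get i) n a₀ x) ^ 2 ≤ ν)
    {lam : ℝ} (hlam : lam < β₂₃ - 2 * ν - κ₂) {y₁ : ℝ} (hy : y₁ ≤ Real.log 4 - c)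
    (hPSD : ∀ α : Fin R.length → ℝ, 0 ≤ ∑ i, ∑ j, α i * α j *
      ((weilPoleForm₂ (v i) (v j) + weilDirichletEnergy₂ c' (v i) (v j) -
          weilMarkovConstant c' * ∫ x, (v i x * conj (v j x)).re) - lam * (∫ x, (v i x * conj (v j x)).re) -
        ∫ y, {u : ℝ | y₁ ≤ |u|}.piecewise (fun _ ↦ 1 / (β₂₃ - 2 * ν - κ₂ - lam))
            (fun _ ↦ 1 / (β₂₃ - 2 * ν - lam)) y *
          ((Fx i - ∑ l, W i l • v l) y * conj ((Fx j - ∑ l, W j l • v l) y)).re)) :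
    lam ≤ weilEvenGroundEnergy c := by
  have hc : 0 < c := lt_of_lt_of_le ((Real.log_pos (by norm_num)).trans hc'2) hcc
  refine le_weilEvenGroundEnergy_of_forall hc fun φ hφ hφs hφe hφn ↦ ?_
  have h := dt_sector_bound_of_deflCert_wx hc'2 hcc hc5 hcb hca 1 R n
    (fun i x ↦ by rw [maskPoly_neg_of_even (R.get i) (hReven i) n a₀ x]; ring) hRμ
    (fun g hg hgs hgp ↦ hcert23 g hg hgs (fun x ↦ by simpa using hgp x)) v Fx hv hFx W hκ hν hlam hy hPSD hφ hφs
    (fun x ↦ by simpa using hφe x)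
  rwa [hφn, mul_one] at h

end Summit.RiemannHypothesis.RiemannHypothesis.Theorems.EvenWinsBeyondArch

end
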